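import Literature.Geometry.Kaehler.LinearSliceIdeal
import Literature.Geometry.Kaehler.HolomorphicLineBundleCechBanach
import HarnessLib

/-!
# The ideal of a linear slice and the regular sequence of linear coordinates, on a chart set

Layer `Literature/Geometry/Kaehler`. Transport of the linear-slice theorems of `LinearSliceIdeal`
(K. Fritzsche, H. Grauert, *From Holomorphic Functions to Complex Manifolds* (2002), Ch. V §1
Prop. 1.6 and §3; J.-P. Serre, *GAGA* (1956), n° 16 Lemme 8: after straightening, the `n` hyperplane
sections of the flag are LINEAR coordinates `ℓᵢ` of the chart and form a regular sequence generating
the ideal of their common zero set over every convex chart piece) from a convex open subset `C` of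
the model space `E` to the chart set `W = chartSet 𝓘(ℝ, E) x₀ C` of a complex manifold `M`, the
functions being `ℓᵢ ∘ extChartAt x₀` (continuous linear functionals `ℓᵢ` with dual vectors, read
through the chart at `x₀`):

* `exists_mdifferentiableOn_eq_sum_mul_of_forall_eq_zero_chartSet` — a holomorphic `f` on `W`
  vanishing on `W ∩ {ℓᵢ ∘ e_{x₀} = 0, i ∈ J}` writes `f = Σ_{i ∈ J} (ℓᵢ ∘ e_{x₀}) · gᵢ` with `gᵢ`
  holomorphic on `W` (the Nullstellensatz input `ker ev ⊆ Σ im tⱼ` of the flag tower of Čech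
  complexes, `Literature.AlgebraicGeometry.HodgeTheory.SerreTheoremAFlag.ker_toZ`);
* `exists_mdifferentiableOn_eq_sum_mul_of_mul_eq_sum_mul_chartSet` — if
  `(ℓ_{j₁} ∘ e_{x₀}) · f = Σ_{i ∈ J} (ℓᵢ ∘ e_{x₀}) · qᵢ` on `W` (`j₁ ∉ J`, ANY coefficient functions
  `qᵢ`) then `f = Σ_{i ∈ J} (ℓᵢ ∘ e_{x₀}) · gᵢ` with `gᵢ` holomorphic on `W` (the regular-sequence input
  `regular` of the flag tower, `SerreTheoremAFlag.regular_mulT`).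

Both are `exists_eq_sum_mul_of_forall_eq_zero` / `exists_eq_sum_mul_of_mul_eq_sum_mul` read in
the holomorphic chart at `x₀` (the idiom of `TransversalPairChart`). Everything is proved; theorems only.

## References

* K. Fritzsche, H. Grauert, *From Holomorphic Functions to Complex Manifolds*, GTM 213 (2002),
  Ch. V §1 Prop. 1.6, §3. [FritzscheGrauert2002]
* J.-P. Serre, *Géométrie algébrique et géométrie analytique*, Ann. Inst. Fourier 6 (1956), n° 16
  Lemme 8. [SerreGAGA1956]
-/

noncomputable section

open scoped Manifold ContDiff Topology
open Set Filter

namespace Literature.Geometry.Kaehler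

universe u v

variable {κ : Type v} [DecidableEq κ]
  {E : Type u} [NormedAddCommGroup E] [NormedSpace ℂ E] [FiniteDimensional ℂ E]
  {M : Type*} [TopologicalSpace M] [ChartedSpace E M] [IsManifold 𝓘(ℂ, E) ω M]

/-- **The ideal of a linear slice, on a chart set.** On `W = chartSet 𝓘(ℝ, E) x₀ C` (`C` open
convex in the chart target), for continuous linear functionals `ℓᵢ` (`i ∈ J`) with dual vectors `eⱼ`
(`ℓᵢ(eⱼ) = δᵢⱼ` on `J`), every `f` holomorphic on `W` vanishing on `W ∩ {ℓᵢ(e_{x₀} ·) = 0, i ∈ J}`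
writes `f = Σ_{i ∈ J} ℓᵢ(e_{x₀} ·) · gᵢ` on `W` with `gᵢ` holomorphic on `W` (`e_{x₀}` the extended
chart at `x₀`; `exists_eq_sum_mul_of_forall_eq_zero` read in the chart).
[cite: FritzscheGrauert2002, Ch. V §1 Prop. 1.6 and §3] [cite: SerreGAGA1956, n° 16 Lemme 8] -/
theorem exists_mdifferentiableOn_eq_sum_mul_of_forall_eq_zero_chartSet (x₀ : M) {C : Set E}
    (hCo : IsOpen C) (hCc : Convex ℝ C) (hCT : C ⊆ (extChartAt 𝓘(ℝ, E) x₀).target)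
    (J : Finset κ) (ℓ : κ → E →L[ℂ] ℂ) (e : κ → E)
    (hdual : ∀ i ∈ J, ∀ j ∈ J, ℓ i (e j) = if i = j then 1 else 0)
    {f : M → ℂ} (hf : MDifferentiableOn 𝓘(ℂ, E) 𝓘(ℂ, ℂ) f (chartSet 𝓘(ℝ, E) x₀ C))
    (hf0 : ∀ x ∈ chartSet 𝓘(ℝ, E) x₀ C, (∀ i ∈ J, ℓ i (extChartAt 𝓘(ℝ, E) x₀ x) = 0) → f x = 0) :
    ∃ g : κ → M → ℂ, (∀ i, MDifferentiableOn 𝓘(ℂ, E) 𝓘(ℂ, ℂ) (g i) (chartSet 𝓘(ℝ, E) x₀ C)) ∧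
      ∀ x ∈ chartSet 𝓘(ℝ, E) x₀ C, f x = ∑ i ∈ J, ℓ i (extChartAt 𝓘(ℝ, E) x₀ x) * g i x := by
  set φ := extChartAt 𝓘(ℂ, E) x₀ with hφ
  set W := chartSet 𝓘(ℝ, E) x₀ C with hW
  have hWo : IsOpen W := isOpen_chartSet 𝓘(ℝ, E) x₀ hCo
  have hWs : W ⊆ φ.source := chartSet_subset_source 𝓘(ℝ, E) x₀ C
  have hφW : ∀ x ∈ W, φ x ∈ C := fun x hx ↦ (mem_chartSet_iff.1 hx).2
  have hsymm : ∀ y ∈ C, φ.symm y ∈ W := fun y hy ↦ symm_mem_chartSet hCT hy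
  -- the data read in the chart
  have hrd : ∀ {u : M → ℂ}, MDifferentiableOn 𝓘(ℂ, E) 𝓘(ℂ, ℂ) u W → DifferentiableOn ℂ (u ∘ φ.symm) C :=
    fun hu ↦ (differentiableOn_comp_extChartAt_symm_of_mdifferentiableOn hu hWo x₀).mono
      fun y hy ↦ ⟨hCT hy, hsymm y hy⟩
  have hf0' : ∀ y ∈ C, (∀ i ∈ J, ℓ i y = 0) → (f ∘ φ.symm) y = 0 := fun y hy h0 ↦ by
    refine hf0 _ (hsymm y hy) fun i hi ↦ ?_
    rw [show extChartAt 𝓘(ℝ, E) x₀ (φ.symm y) = y from φ.right_inv (hCT hy)]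
    exact h0 i hi
  obtain ⟨g₀, hg₀, hfg₀⟩ := exists_eq_sum_mul_of_forall_eq_zero J ℓ e hdual hCo hCc (hrd hf) hf0'
  refine ⟨fun i x ↦ g₀ i (φ x), fun i x hx ↦ ?_, fun x hx ↦ ?_⟩
  · have hxs : x ∈ (chartAt E x₀).source := by
      rw [← extChartAt_source 𝓘(ℂ, E)]; exact hWs hx
    have h1 : MDifferentiableAt 𝓘(ℂ, E) 𝓘(ℂ, ℂ) (g₀ i) (φ x) :=
      mdifferentiableAt_iff_differentiableAt.2 ((hg₀ i).differentiableAt (hCo.mem_nhds (hφW x hx)))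
    exact (h1.comp x (mdifferentiableAt_extChartAt hxs)).mdifferentiableWithinAt
  · have h1 := hfg₀ (φ x) (hφW x hx)
    simp only [Function.comp_apply, φ.left_inv (hWs hx)] at h1
    exact h1

/-- **Independent linear coordinates form a regular sequence on `𝒪(W)`, `W` a chart set.** On
`W = chartSet 𝓘(ℝ, E) x₀ C` (`C` open convex in the chart target), with `ℓ`, `e` dual on
`insert j₁ J` (`j₁ ∉ J`): if `f` is holomorphic on `W` and
`ℓ_{j₁}(e_{x₀} ·) · f = Σ_{i ∈ J} ℓᵢ(e_{x₀} ·) · qᵢ` on `W` for SOME functions `qᵢ`, then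
`f = Σ_{i ∈ J} ℓᵢ(e_{x₀} ·) · gᵢ` on `W` with `gᵢ` holomorphic on `W`
(`exists_eq_sum_mul_of_mul_eq_sum_mul` read in the chart).
[cite: SerreGAGA1956, n° 16 Lemme 8] [cite: FritzscheGrauert2002, Ch. V §3] -/
theorem exists_mdifferentiableOn_eq_sum_mul_of_mul_eq_sum_mul_chartSet (x₀ : M) {C : Set E}
    (hCo : IsOpen C) (hCc : Convex ℝ C) (hCT : C ⊆ (extChartAt 𝓘(ℝ, E) x₀).target)
    (J : Finset κ) {j₁ : κ} (hj₁ : j₁ ∉ J) (ℓ : κ → E →L[ℂ] ℂ) (e : κ → E)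
    (hdual : ∀ i ∈ insert j₁ J, ∀ j ∈ insert j₁ J, ℓ i (e j) = if i = j then 1 else 0)
    {f : M → ℂ} (hf : MDifferentiableOn 𝓘(ℂ, E) 𝓘(ℂ, ℂ) f (chartSet 𝓘(ℝ, E) x₀ C))
    {q : κ → M → ℂ}
    (hq : ∀ x ∈ chartSet 𝓘(ℝ, E) x₀ C,
      ℓ j₁ (extChartAt 𝓘(ℝ, E) x₀ x) * f x = ∑ i ∈ J, ℓ i (extChartAt 𝓘(ℝ, E) x₀ x) * q i x) :
    ∃ g : κ → M → ℂ, (∀ i, MDifferentiableOn 𝓘(ℂ, E) 𝓘(ℂ, ℂ) (g i) (chartSet 𝓘(ℝ, E) x₀ C)) ∧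
      ∀ x ∈ chartSet 𝓘(ℝ, E) x₀ C, f x = ∑ i ∈ J, ℓ i (extChartAt 𝓘(ℝ, E) x₀ x) * g i x := by
  set φ := extChartAt 𝓘(ℂ, E) x₀ with hφ
  set W := chartSet 𝓘(ℝ, E) x₀ C with hW
  have hWo : IsOpen W := isOpen_chartSet 𝓘(ℝ, E) x₀ hCo
  have hWs : W ⊆ φ.source := chartSet_subset_source 𝓘(ℝ, E) x₀ C
  have hφW : ∀ x ∈ W, φ x ∈ C := fun x hx ↦ (mem_chartSet_iff.1 hx).2
  have hsymm : ∀ y ∈ C, φ.symm y ∈ W := fun y hy ↦ symm_mem_chartSet hCT hy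
  have hrd : ∀ {u : M → ℂ}, MDifferentiableOn 𝓘(ℂ, E) 𝓘(ℂ, ℂ) u W → DifferentiableOn ℂ (u ∘ φ.symm) C :=
    fun hu ↦ (differentiableOn_comp_extChartAt_symm_of_mdifferentiableOn hu hWo x₀).mono
      fun y hy ↦ ⟨hCT hy, hsymm y hy⟩
  have hq' : ∀ y ∈ C, ℓ j₁ y * (f ∘ φ.symm) y = ∑ i ∈ J, ℓ i y * (fun i y ↦ q i (φ.symm y)) i y :=
    fun y hy ↦ by
      have h := hq _ (hsymm y hy)
      rw [show extChartAt 𝓘(ℝ, E) x₀ (φ.symm y) = y from φ.right_inv (hCT hy)] at h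
      simpa only [Function.comp_apply] using h
  obtain ⟨g₀, hg₀, hfg₀⟩ := exists_eq_sum_mul_of_mul_eq_sum_mul J hj₁ ℓ e hdual hCo hCc (hrd hf) hq'
  refine ⟨fun i x ↦ g₀ i (φ x), fun i x hx ↦ ?_, fun x hx ↦ ?_⟩
  · have hxs : x ∈ (chartAt E x₀).source := by
      rw [← extChartAt_source 𝓘(ℂ, E)]; exact hWs hx
    have h1 : MDifferentiableAt 𝓘(ℂ, E) 𝓘(ℂ, ℂ) (g₀ i) (φ x) :=
      mdifferentiableAt_iff_differentiableAt.2 ((hg₀ i).differentiableAt (hCo.mem_nhds (hφW x hx)))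
    exact (h1.comp x (mdifferentiableAt_extChartAt hxs)).mdifferentiableWithinAt
  · have h1 := hfg₀ (φ x) (hφW x hx)
    simp only [Function.comp_apply, φ.left_inv (hWs hx)] at h1
    exact h1

end Literature.Geometry.Kaehler

end
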